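import Summits.QuantumAdvantage.QuantumAdvantage.Theorems.CertDialE
import HarnessLib

/-!
# CertDial (F) — decomp-qadv lens-2 (structural dichotomy: special vs generic), generation 28, part 6/6

Part 6 of NODE «CertDial» (memo in part A's header and `NODE-g28.md`): §8 THE LIGHT-INPUT KERNEL ATLAS (degree-free, class-free).  By parts
A–E any proof of a generic leaf must choose the refuting light input ADAPTIVELY from the strategy; the raw material is the light constraint system
itself, given here in CLOSED FORM up to weight 3 for even lengths.  UNIQUENESS PRINCIPLE `kvec_eq_of_inKernel` (an explicit nonzero kernel vector of
an odd-class input IS `kvec`, from `kernel_pair_of_oddZeros`) ⇒ `rel_iff_of_explicit` (the ring relation is ONE explicit parity constraint).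
★ MONOCHROMATIC LAW `rel_mono_iff` / `win_mono_iff`: if every one of the odd-class input `x` has parity `q` then, for ANY answer `z`,
`Rel x z ⟺ #{b : par b ≠ q, z b = 1} is even` (kernel vector `oppVec` = the opposite parity class, sign bit `0`; `rel_single_iff` = weight 1).
★ TWO-ONE LAW `rel_tri_iff` / `win_tri_iff` (weight 3, parity pattern `p p q̄`, normalised by rotation — general position via `rel_rot`): for
`x = 1_{0,d,k}`, `d` even, `k` odd, `2 ≤ d < k < n`: `Rel x z ⟺ #{b : (b even ∨ b < d), z b = 1} is odd` (kernel vector `arcVec` = evens ∪ the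
arc `[0,d)`, sign bit `1`); §8c `rel_triAt_iff` / `win_triAt_iff` = the same law AT ANY POSITION `i` (ones at offsets `0, d, e` from `i`; electorate
`offs b i` even or `< d`; transported by `inKernel_rot` / `signBit_rot`).  Together: the complete weight-`≤ 3` constraint system for even `n`,
the entry point of the structure-forcing programme for the affine rung (NEXT-g29).  Nothing here proves or refutes the generic leaves or 27432.
`lean check` (own closure) rc 0 · 0 sorry · 0 warning; axioms standard.
-/

set_option linter.dupNamespace false
set_option linter.style.longLine false

noncomputable section
open scoped Classical

namespace Summit.QuantumAdvantage.QuantumAdvantage.Theorems.CertDial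
open Finset
open Literature.Computability.QuantumComplexity Literature.Computability.QuantumComplexity.RingHLF
open Summit.QuantumAdvantage.AdviceFreeQNC0
open Literature.Computability.MetaComplexity Literature.Computability.MetaComplexity.Smolensky
open Summit.QuantumAdvantage.QuantumAdvantage.Theorems.RingPeriodFold
  (kvec kernel_pair_of_oddZeros kvec_ne_zero rel_iff_of_kernel_pair)
open Summit.QuantumAdvantage.QuantumAdvantage.Theorems.LightDial (wt lightLosing LightFail mono_singleton_apply)
open Summit.QuantumAdvantage.QuantumAdvantage.Theorems.ParityDial (PGlobalFail OGlobalFail PLocalFail IsParityLocal par ecntOff ocntOff)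
open Summit.QuantumAdvantage.AdviceFreeQNC0.LightConeWindowHard (window)
open Summit.QuantumAdvantage.QuantumAdvantage.Theses.ExactnessDial (NoPerfectTwo3)

variable {n : ℕ}

open Summit.QuantumAdvantage.QuantumAdvantage.Theorems.ParityDial (OffsetCombFail IsOffsetCombLocal)
open Summit.QuantumAdvantage.AdviceFreeQNC0.RingSymmetry (shift rot_apply rel_rot card_filter_shift)

/-! ## §8 LIGHT-INPUT KERNEL ATLAS (degree-free, class-free): the weight-`≤ 3` constraints in CLOSED FORM, even `n`

By Theorems A′/B′ any proof of a generic leaf must choose the refuting light input ADAPTIVELY from the strategy; the raw material for that is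
the light constraint system itself.  UNIQUENESS PRINCIPLE (`kvec_eq_of_inKernel`, from `kernel_pair_of_oddZeros`): an explicit nonzero kernel
vector IS `kvec`, so `Rel x z` is ONE explicit parity constraint (`rel_iff_of_explicit`).  Two explicit kernel vectors then give the whole
weight-`≤ 3` system for even `n` (weights 1 and 3 = parity patterns `ppp` and `ppq̄`):
★ MONOCHROMATIC LAW `rel_mono_iff`: if all ones of the odd-class input `x` have parity `q`, then `Rel x z ⟺ #{b : par b ≠ q, z b} is even`
(kernel vector = the opposite parity class, sign `0`; covers weight 1 (`rel_single_iff`) and every all-even / all-odd light input);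
★ TWO-ONE LAW `rel_tri_iff` (normalised by rotation, `rel_rot`): for `x = 1_{0, d, k}`, `d` even, `k` odd, `2 ≤ d < k < n`:
`Rel x z ⟺ #{b : (b even ∨ b < d), z b} is odd` (kernel vector = evens ∪ the arc `[0, d)`, sign `1`). -/

/-- UNIQUENESS: a nonzero kernel vector of an odd-class input is THE kernel vector `kvec`. -/
theorem kvec_eq_of_inKernel (hn : 3 ≤ n) {x V : Fin n → Bool} (hx : OddZeros x) (hV : InKernel x V) (hV0 : V ≠ fun _ => false) :
    kvec x = V :=
  (((kernel_pair_of_oddZeros hn hx V).1 hV).resolve_left hV0).symm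

/-- hence the ring relation of an odd-class input against an EXPLICIT kernel vector is one parity constraint. -/
theorem rel_iff_of_explicit (hn : 3 ≤ n) {x V : Fin n → Bool} (hx : OddZeros x) (hV : InKernel x V) (hV0 : V ≠ fun _ => false)
    (z : Fin n → Bool) : Rel x z ↔ dot2 V z = signBit x V := by
  have hk := kvec_eq_of_inKernel hn hx hV hV0
  exact rel_iff_of_kernel_pair x V z fun v => by rw [kernel_pair_of_oddZeros hn hx v, hk]

/-- the kernel equation at one position, as a proposition: `v(b-1) ⊕ v(b+1) ⊕ (x b ∧ v b) = 0 ⟺ ((v(b-1) ↔ v(b+1)) ↔ ¬(x b ∧ v b))`. -/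
theorem xor_xor_and_eq_false_iff (a b c e : Bool) :
    (xor (xor a b) (c && e)) = false ↔ ((a = true ↔ b = true) ↔ ¬ (c = true ∧ e = true)) := by
  revert a b c e; decide

/-- parity of the cyclic successor, even `n`. -/
theorem nxt_mod_two (he : n % 2 = 0) (b : Fin n) : ((nxt b : Fin n) : ℕ) % 2 = ((b : ℕ) + 1) % 2 := by
  have := b.isLt
  rw [LightConeWindowHard.nxt_val]; split_ifs <;> omega

/-- parity of the cyclic predecessor, even `n`. -/
theorem prv_mod_two (he : n % 2 = 0) (b : Fin n) : ((prv b : Fin n) : ℕ) % 2 = ((b : ℕ) + 1) % 2 := by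
  have := b.isLt
  rw [LightConeWindowHard.prv_val]; split_ifs <;> omega

/-! ### §8a The monochromatic law (weights 1, 3, 5, 7 inside one parity class) -/

/-- the OPPOSITE-PARITY vector of the class `q` (`q = true` = even): `1` exactly at the positions of parity `≠ q`. -/
def oppVec (n : ℕ) (q : Bool) : Fin n → Bool := fun b => decide (par b ≠ q)

/-- its entries. -/
theorem oppVec_apply (q : Bool) (b : Fin n) : oppVec n q b = true ↔ par b ≠ q := by simp [oppVec]

/-- a MONOCHROMATIC input (all ones of parity `q`) has the opposite-parity class in its kernel (even `n`). -/
theorem inKernel_oppVec (he : n % 2 = 0) {x : Fin n → Bool} {q : Bool} (hx : ∀ b, x b = true → par b = q) :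
    InKernel x (oppVec n q) := by
  intro b
  have h1 : oppVec n q (prv b) = oppVec n q (nxt b) := by
    simp only [oppVec, par, prv_mod_two he, nxt_mod_two he]
  have h2 : (x b && oppVec n q b) = false := by
    cases hxb : x b
    · rfl
    · simp [oppVec, hx b hxb]
  rw [h1, Bool.xor_self, h2]; rfl

/-- the opposite-parity vector is nonzero (`n ≥ 2`). -/
theorem oppVec_ne_zero (hn : 2 ≤ n) (q : Bool) : oppVec n q ≠ fun _ => false := by
  intro h
  cases q
  · have := congrFun h ⟨0, by omega⟩; simp [oppVec, par] at this
  · have := congrFun h ⟨1, by omega⟩; simp [oppVec, par] at this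

/-- no ring edge lies inside one parity class (even `n`). -/
theorem edgesIn_oppVec (he : n % 2 = 0) (q : Bool) : edgesIn (oppVec n q) = 0 := by
  unfold edgesIn
  rw [Finset.card_eq_zero, Finset.filter_eq_empty_iff]
  intro b _
  simp only [oppVec, par, nxt_mod_two he, ne_eq, decide_eq_true_eq]
  cases q <;> simp <;> omega

/-- a monochromatic input does not meet the opposite class. -/
theorem wtAnd_oppVec {x : Fin n → Bool} {q : Bool} (hx : ∀ b, x b = true → par b = q) : wtAnd x (oppVec n q) = 0 := by
  unfold wtAnd
  rw [Finset.card_eq_zero, Finset.filter_eq_empty_iff]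
  rintro b - ⟨hb, hV⟩
  exact (oppVec_apply q b).1 hV (hx b hb)

/-- so its sign bit against the opposite class is `0`. -/
theorem signBit_oppVec (he : n % 2 = 0) {x : Fin n → Bool} {q : Bool} (hx : ∀ b, x b = true → par b = q) :
    signBit x (oppVec n q) = 0 := by
  unfold signBit; rw [edgesIn_oppVec he, wtAnd_oppVec hx]

/-- ★ MONOCHROMATIC LAW.  For even `n ≥ 3`... i.e. `n ≥ 4`, an odd-class input all of whose ones have parity `q`, and ANY answer `z`:
`Rel x z ⟺ the number of `1`-answers at positions of parity `≠ q` is even`.  (Degree-free, class-free; the kernel vector of every such input is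
the opposite parity class and its sign bit is `0`.) -/
theorem rel_mono_iff (he : n % 2 = 0) (hn : 3 ≤ n) {x : Fin n → Bool} (hx : OddZeros x) {q : Bool} (hq : ∀ b, x b = true → par b = q)
    (z : Fin n → Bool) : Rel x z ↔ (univ.filter fun b : Fin n => par b ≠ q ∧ z b = true).card % 2 = 0 := by
  rw [rel_iff_of_explicit hn hx (inKernel_oppVec he hq) (oppVec_ne_zero (by omega) q) z, signBit_oppVec he hq]
  unfold dot2
  rw [Finset.filter_congr fun b _ => show (oppVec n q b = true ∧ z b = true) ↔ (par b ≠ q ∧ z b = true) by rw [oppVec_apply]]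

/-- the single-one input `e_j`. -/
def single (j : Fin n) : Fin n → Bool := fun b => decide (b = j)

/-- `e_j` is in the odd class for even `n`. -/
theorem oddZeros_single (he : n % 2 = 0) (j : Fin n) : OddZeros (single j) := by
  have := j.isLt
  unfold OddZeros
  rw [show (univ.filter fun b : Fin n => single j b = false) = univ.erase j by
    ext b; simp [single], Finset.card_erase_of_mem (Finset.mem_univ j), Finset.card_univ, Fintype.card_fin]
  omega

/-- ★ WEIGHT-ONE LAW: `Rel e_j z ⟺ #{b : par b ≠ par j, z b = 1} even` (even `n ≥ 4`). -/
theorem rel_single_iff (he : n % 2 = 0) (hn : 3 ≤ n) (j : Fin n) (z : Fin n → Bool) :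
    Rel (single j) z ↔ (univ.filter fun b : Fin n => par b ≠ par j ∧ z b = true).card % 2 = 0 :=
  rel_mono_iff he hn (oddZeros_single he j) (fun b hb => by simp [single] at hb; rw [hb]) z

/-- the monochromatic law in strategy language: a strategy wins a `q`-monochromatic odd-class input iff it gives an even number of `1`-answers
on the opposite class. -/
theorem win_mono_iff (he : n % 2 = 0) (hn : 3 ≤ n) {x : Fin n → Bool} (hx : OddZeros x) {q : Bool} (hq : ∀ b, x b = true → par b = q)
    (P : Fin n → CubeFn (ZMod 3) n) : Rel x (ans P x) ↔ (univ.filter fun b : Fin n => par b ≠ q ∧ P b x = 1).card % 2 = 0 := by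
  rw [rel_mono_iff he hn hx hq]
  rw [Finset.filter_congr fun b _ => show (par b ≠ q ∧ ans P x b = true) ↔ (par b ≠ q ∧ P b x = 1) by simp [ans]]

/-! ### §8b The two-one law (weight 3, parity pattern `p p q̄`), normalised by rotation -/

/-- the normalised two-one input `1_{0, d, k}`. -/
def tri (n d k : ℕ) : Fin n → Bool := fun b => decide ((b : ℕ) = 0 ∨ (b : ℕ) = d ∨ (b : ℕ) = k)

/-- its kernel vector: the even positions together with the arc `[0, d)`. -/
def arcVec (n d : ℕ) : Fin n → Bool := fun b => decide ((b : ℕ) % 2 = 0 ∨ (b : ℕ) < d)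

/-- `1_{0,d,k}` is in the odd class (even `n`, `0 < d < k < n` distinct). -/
theorem oddZeros_tri (he : n % 2 = 0) {d k : ℕ} (hd : 2 ≤ d) (hdk : d < k) (hk : k < n) : OddZeros (tri n d k) := by
  unfold OddZeros
  have h3 : (univ.filter fun b : Fin n => tri n d k b = true).card = 3 := by
    rw [Finset.card_eq_three]
    refine ⟨⟨0, by omega⟩, ⟨d, by omega⟩, ⟨k, hk⟩, ?_, ?_, ?_, ?_⟩
    · simp [Fin.ext_iff]; omega
    · simp [Fin.ext_iff]; omega
    · simp [Fin.ext_iff]; omega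
    · ext b; simp [tri, Fin.ext_iff]
  have hc := Finset.card_filter_add_card_filter_not (s := (univ : Finset (Fin n))) (fun b : Fin n => tri n d k b = true)
  rw [h3, Finset.card_univ, Fintype.card_fin] at hc
  rw [Finset.filter_congr fun b _ => show (tri n d k b = false) ↔ ¬ (tri n d k b = true) by simp]
  omega

/-- the arc vector lies in the kernel of the two-one input (even `n`, `d` even, `k` odd, `2 ≤ d < k < n`). -/
theorem inKernel_arcVec (he : n % 2 = 0) {d k : ℕ} (hd2 : d % 2 = 0) (hk2 : k % 2 = 1) (hd : 2 ≤ d) (hdk : d < k) (hk : k < n) :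
    InKernel (tri n d k) (arcVec n d) := by
  intro b
  have hb := b.isLt
  rw [xor_xor_and_eq_false_iff]
  simp only [arcVec, tri, decide_eq_true_eq, LightConeWindowHard.prv_val, LightConeWindowHard.nxt_val]
  split_ifs <;> omega

/-- the arc vector is nonzero. -/
theorem arcVec_ne_zero (hn : 1 ≤ n) (d : ℕ) : arcVec n d ≠ fun _ => false := by
  intro h; have := congrFun h ⟨0, by omega⟩; simp [arcVec] at this

/-- the ring edges inside the arc vector are exactly those starting in `[0, d)`: there are `d` of them. -/
theorem edgesIn_arcVec (he : n % 2 = 0) {d : ℕ} (hd2 : d % 2 = 0) (hdn : d + 2 ≤ n) : edgesIn (arcVec n d) = d := by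
  unfold edgesIn
  rw [Finset.filter_congr fun (b : Fin n) _ => show (arcVec n d b = true ∧ arcVec n d (nxt b) = true) ↔ (b : ℕ) < d by
    have hb := b.isLt
    simp only [arcVec, decide_eq_true_eq, LightConeWindowHard.nxt_val]
    split_ifs <;> omega]
  rw [Fin.card_filter_val_lt]; omega

/-- the two-one input meets its kernel vector in the two even ones. -/
theorem wtAnd_arcVec {d k : ℕ} (hd2 : d % 2 = 0) (hk2 : k % 2 = 1) (hd : 2 ≤ d) (hdk : d < k) (hk : k < n) : wtAnd (tri n d k) (arcVec n d) = 2 := by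
  unfold wtAnd
  rw [Finset.card_eq_two]
  refine ⟨⟨0, by omega⟩, ⟨d, by omega⟩, ?_, ?_⟩
  · simp [Fin.ext_iff]; omega
  · ext b; simp only [Finset.mem_filter, Finset.mem_univ, true_and, tri, arcVec, decide_eq_true_eq, Finset.mem_insert,
      Finset.mem_singleton, Fin.ext_iff]
    omega

/-- so the sign bit of the two-one input is `1`. -/
theorem signBit_arcVec (he : n % 2 = 0) {d k : ℕ} (hd2 : d % 2 = 0) (hk2 : k % 2 = 1) (hd : 2 ≤ d) (hdk : d < k) (hk : k < n) :
    signBit (tri n d k) (arcVec n d) = 1 := by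
  unfold signBit
  rw [edgesIn_arcVec he hd2 (by omega), wtAnd_arcVec hd2 hk2 hd hdk hk]
  omega

/-- ★ TWO-ONE LAW (normalised).  Even `n`, `x = 1_{0, d, k}` with `d` even, `k` odd, `2 ≤ d < k < n`, ANY answer `z`:
`Rel x z ⟺ the number of `1`-answers at the positions that are even OR lie in the arc [0, d) is odd`.  Every weight-3 input of parity
pattern `p p q̄` is a rotation of one of these (start at the `p`-one from which the other `p`-one is met before the `q̄`-one; `rel_rot`), so
§8a–§8b are the complete weight-`≤ 3` constraint system for even lengths. -/
theorem rel_tri_iff (he : n % 2 = 0) (hn : 3 ≤ n) {d k : ℕ} (hd2 : d % 2 = 0) (hk2 : k % 2 = 1) (hd : 2 ≤ d) (hdk : d < k) (hk : k < n)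
    (z : Fin n → Bool) :
    Rel (tri n d k) z ↔ (univ.filter fun b : Fin n => ((b : ℕ) % 2 = 0 ∨ (b : ℕ) < d) ∧ z b = true).card % 2 = 1 := by
  rw [rel_iff_of_explicit hn (oddZeros_tri he hd hdk hk) (inKernel_arcVec he hd2 hk2 hd hdk hk) (arcVec_ne_zero (by omega) d) z,
    signBit_arcVec he hd2 hk2 hd hdk hk]
  unfold dot2
  rw [Finset.filter_congr fun (b : Fin n) _ => show (arcVec n d b = true ∧ z b = true) ↔ (((b : ℕ) % 2 = 0 ∨ (b : ℕ) < d) ∧ z b = true) by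
    simp [arcVec]]

/-- the two-one law in strategy language. -/
theorem win_tri_iff (he : n % 2 = 0) (hn : 3 ≤ n) {d k : ℕ} (hd2 : d % 2 = 0) (hk2 : k % 2 = 1) (hd : 2 ≤ d) (hdk : d < k) (hk : k < n)
    (P : Fin n → CubeFn (ZMod 3) n) :
    Rel (tri n d k) (ans P (tri n d k)) ↔
      (univ.filter fun b : Fin n => ((b : ℕ) % 2 = 0 ∨ (b : ℕ) < d) ∧ P b (tri n d k) = 1).card % 2 = 1 := by
  rw [rel_tri_iff he hn hd2 hk2 hd hdk hk]
  rw [Finset.filter_congr fun (b : Fin n) _ => show (((b : ℕ) % 2 = 0 ∨ (b : ℕ) < d) ∧ ans P (tri n d k) b = true) ↔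
      (((b : ℕ) % 2 = 0 ∨ (b : ℕ) < d) ∧ P b (tri n d k) = 1) by simp [ans]]


/-! ### §8c The two-one law in general position (transport by rotation) -/

open Summit.QuantumAdvantage.QuantumAdvantage.Theorems.ParityDial (offs)
open Summit.QuantumAdvantage.AdviceFreeQNC0.RingSymmetry (inKernel_rot signBit_rot)

/-- rotating by `n - i` reads offsets from `i`: `shift (n - i) b = offs b i` (as numbers). -/
theorem shift_val_eq_offs (i b : Fin n) : ((shift n (n - (i : ℕ)) b : Fin n) : ℕ) = offs b i := by
  have hi := i.isLt; have hb := b.isLt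
  simp only [shift, offs]
  split_ifs with h
  · rw [show (b : ℕ) + (n - i) = (b - i) + n by omega, Nat.add_mod_right, Nat.mod_eq_of_lt (by omega)]
  · rw [show (b : ℕ) + (n - i) = (b : ℕ) + n - i by omega]; exact Nat.mod_eq_of_lt (by omega)

/-- for even `n`, «even offset from `i`» is «same parity as `i`». -/
theorem offs_mod_two_iff (he : n % 2 = 0) (b i : Fin n) : offs b i % 2 = 0 ↔ par b = par i := by
  have hi := i.isLt; have hb := b.isLt
  simp only [offs, par, decide_eq_decide]
  split_ifs <;> omega

/-- the two-one input AT position `i`: ones at offsets `0, d, e` from `i`. -/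
def triAt (i : Fin n) (d e : ℕ) : Fin n → Bool := fun b => decide (offs b i = 0 ∨ offs b i = d ∨ offs b i = e)

/-- its kernel vector: the positions at an even offset from `i` or at offset `< d`. -/
def arcAt (i : Fin n) (d : ℕ) : Fin n → Bool := fun b => decide (offs b i % 2 = 0 ∨ offs b i < d)

/-- `triAt` is the rotated normal form. -/
theorem triAt_eq_rot (i : Fin n) (d e : ℕ) : triAt i d e = rot (n - (i : ℕ)) (tri n d e) := by
  funext b; simp only [triAt, tri, rot_apply, shift_val_eq_offs]

/-- `arcAt` is the rotated arc vector. -/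
theorem arcAt_eq_rot (i : Fin n) (d : ℕ) : arcAt i d = rot (n - (i : ℕ)) (arcVec n d) := by
  funext b; simp only [arcAt, arcVec, rot_apply, shift_val_eq_offs]

/-- ★ TWO-ONE LAW in general position.  Even `n`, ones at `i`, `i + d`, `i + e` (mod `n`) with `d` even, `e` odd, `2 ≤ d < e < n`, ANY answer `z`:
`Rel x z ⟺ #{b : (offs b i even ∨ offs b i < d), z b = 1} is odd` — the electorate is the parity class of `i` (`offs_mod_two_iff`) together with the
arc from `i` to `i + d`.  With `rel_mono_iff` this is every weight-3 constraint at even length, at every position. -/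
theorem rel_triAt_iff (he : n % 2 = 0) (hn : 3 ≤ n) (i : Fin n) {d e : ℕ} (hd2 : d % 2 = 0) (he2 : e % 2 = 1) (hd : 2 ≤ d) (hde : d < e)
    (hen : e < n) (z : Fin n → Bool) :
    Rel (triAt i d e) z ↔ (univ.filter fun b : Fin n => (offs b i % 2 = 0 ∨ offs b i < d) ∧ z b = true).card % 2 = 1 := by
  have hodd : OddZeros (triAt i d e) := by
    rw [triAt_eq_rot]; unfold OddZeros
    rw [show (univ.filter fun b : Fin n => rot (n - (i : ℕ)) (tri n d e) b = false) =
        univ.filter fun b : Fin n => tri n d e (shift n (n - (i : ℕ)) b) = false from rfl,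
      card_filter_shift (n - (i : ℕ)) (fun b : Fin n => tri n d e b = false)]
    exact oddZeros_tri he hd hde hen
  have hK : InKernel (triAt i d e) (arcAt i d) := by
    rw [triAt_eq_rot, arcAt_eq_rot, inKernel_rot]; exact inKernel_arcVec he hd2 he2 hd hde hen
  have h0 : arcAt i d ≠ fun _ => false := by
    intro h; have := congrFun h i; simp [arcAt, offs] at this
  have hs : signBit (triAt i d e) (arcAt i d) = 1 := by
    rw [triAt_eq_rot, arcAt_eq_rot, signBit_rot]; exact signBit_arcVec he hd2 he2 hd hde hen
  rw [rel_iff_of_explicit hn hodd hK h0 z, hs]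
  unfold dot2
  rw [Finset.filter_congr fun (b : Fin n) _ => show (arcAt i d b = true ∧ z b = true) ↔ ((offs b i % 2 = 0 ∨ offs b i < d) ∧ z b = true) by
    simp [arcAt]]

/-- the general two-one law in strategy language. -/
theorem win_triAt_iff (he : n % 2 = 0) (hn : 3 ≤ n) (i : Fin n) {d e : ℕ} (hd2 : d % 2 = 0) (he2 : e % 2 = 1) (hd : 2 ≤ d) (hde : d < e)
    (hen : e < n) (P : Fin n → CubeFn (ZMod 3) n) :
    Rel (triAt i d e) (ans P (triAt i d e)) ↔
      (univ.filter fun b : Fin n => (offs b i % 2 = 0 ∨ offs b i < d) ∧ P b (triAt i d e) = 1).card % 2 = 1 := by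
  rw [rel_triAt_iff he hn i hd2 he2 hd hde hen]
  rw [Finset.filter_congr fun (b : Fin n) _ => show ((offs b i % 2 = 0 ∨ offs b i < d) ∧ ans P (triAt i d e) b = true) ↔
      ((offs b i % 2 = 0 ∨ offs b i < d) ∧ P b (triAt i d e) = 1) by simp [ans]]

end Summit.QuantumAdvantage.QuantumAdvantage.Theorems.CertDial
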